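import Literature.NumberTheory.EllipticCurves.Wuthrich2014.SurjectiveMultiplicativeDivisibility
import HarnessLib

/-!
# Wuthrich 2014, Cor. 18: the Néron-normalised `p`-adic `L`-function `L_p(E)` lies in `Λ` for EVERY elliptic curve `E/ℚ` with semi-stable ordinary reduction at `p > 2` — multiplicative clause (named fact)

Topic `Literature/NumberTheory/EllipticCurves` (cluster `Wuthrich2014`). ONE named fact (nothing
asserted), no other declaration. HONEST FRAMING (cell `bsd-stepL`, seat `bsd-stepL-corner-p1`, items
19065 `NonSurjCorner` / 19111 `CornerAtThree`): the tree's integrality facts for the Mazur–Tate–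
Teitelbaum function are `padicLFunction_mem_iwasawaAlgebra` (GOOD ordinary `p ≠ 2`, `E[p]`
irreducible; Greenberg–Vatsal Prop. 3.7 / Stevens) and, at `p ‖ N`, the integrality IMPLICIT in the
three divisibility facts `Wuthrich2014.kato_charIdeal_dvd_multiplicative_of_surjective`,
`Wuthrich2014.thm16_charIdeal_dvd_multiplicative_of_reducible`, `Skinner2016.thmA_charIdeal_multiplicative`
(`ϖ · L ∈ ι(char_Λ X) ⊆ ι(Λ)`), each with an image hypothesis. Wuthrich prints the integrality at a
semi-stable prime `p > 2` for ALL `E` (Cor. 18); this file types its multiplicative clause, the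
integrality input of the corner's `μ`-cancellation (`Theorems/ErratumRoadFiveNonSurjCornerTwinMu.lean`,
binder "`ι(Lᵢ) = ϖ · L`") on the locus where no image hypothesis is available. Nothing here is a class
theorem and nothing is "finishing BSD".

**Source, as PUBLISHED** (C. Wuthrich, *On the integrality of modular symbols and Kato's Euler system
for elliptic curves*, Doc. Math. 19 (2014) 381–402, doi:10.4171/dm/450; held `paper:url-3a091c8881dd`
(journal pagination) and `paper:doi-10-4171-dm-450` (author's 2013 version); read first-hand
2026-08-26).
* §1, Thm. 1 (p. 381): "Let `E/ℚ` be an elliptic curve. Then there exists an elliptic curve `E_•`,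
  which is isogenous to `E` over `ℚ`, such that `[r]^±_{E_•}` is a `p`-integer for all `r ∈ ℚ` and for
  all odd primes `p` for which `E` has semi-stable reduction." and p. 382: "As a direct consequence of
  this theorem 4, one deduces that the algebraic part of the special values of the twisted `L`-series
  `L(E_•, χ, s)` at `s = 1` are `p`-adic integers for all Dirichlet characters `χ` … In particular,
  it is obvious from the construction (see [11]) of the `p`-adic `L`-function …"; Cor. 7 (p. 386):
  "Let `E` be an elliptic curve over `ℚ` and `p` an odd prime for which `E` has semi-stable
  reduction. Then there is a curve `E_•` which is isogenous to `E` over `ℚ` such that for all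
  Dirichlet characters `χ` …".
* §3.2 (p. 394): "We now apply Theorem 16.6 in [10] with this "good choice" of `γ` and with the
  "good choice" of the Néron differential `ω = ω_{E_•}` in the terminology of 17.5. … The theorem
  yields `Col(loc(z)) = L_p(E_•) ∈ Λ`" — `L_p(E)` is the analytic `p`-adic `L`-function normalised by
  the Néron period `Ω_E` (`Λ = ℤ_p⟦Gal(ℚ(ζ_{p^∞})/ℚ)⟧ ⊇ Λ(Γ) = ℤ_p⟦T⟧`, §3 p. 390).
* **§6, Corollary 18** (p. 398): "The analytic `p`-adic `L`-function `L_p(E)` belongs to `Λ` for all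
  elliptic curves `E/ℚ` with semi-stable ordinary reduction at `p > 2`." (author's version: "with
  semi-stable reduction at `p > 2`"; "The conclusion can certainly not be extended to the
  supersingular case since the `p`-adic `L`-functions in this case will never be integral.")
  Context of the proof (p. 398): Thm. 1 / Cor. 7 for `E_•` and Lemma 17 / Thm. 16 (the change of
  `L_p` and of `μ` along an isogeny, Perrin-Riou [16, Appendice]) for the other curves of the class.
No hypothesis on the Galois image, on semistability away from `p`, or on (ram).

**Transcription** (`corollary18_padicLFunction_mem_iwasawaAlgebra_multiplicative`), multiplicative
clause, in EXACTLY the vocabulary of the cluster's divisibility facts: `W` a globally minimal model of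
`E/ℚ`, `p ≠ 2` a prime of MULTIPLICATIVE reduction, `f` the newform of `E`, `ϖ ∈ ℚ` with
`ϖ · Ω_E = Ω⁺_f` (so `ϖ · L` is the Néron-normalised function, as in Cor. 19's transcriptions
`corollary19_{split,nonsplit}Multiplicative`), `L` THE `Ω⁺_f`-normalised Mazur–Tate–Teitelbaum function
(`IsMultPAdicLFunctionOf f p (-1) L` non-split, `IsSplitMultPAdicLFunctionOf f p L` split), `ι : Λ =
ℤ_p⟦T⟧ ↪ ℚ_p⟦T⟧` (`iwasawaToPowerSeries`; the `Γ`-component `Λ(Γ)` of Wuthrich's `Λ`, which is where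
the cyclotomic-`ℤ_p`-extension function lives, §3 p. 390 "`M = ⊕ M_i`"). Conclusion: `ϖ · L = ι G` for
some `G ∈ Λ`. The good ordinary clause is the tree's `padicLFunction_mem_iwasawaAlgebra` (there with
`E[p]` irreducible) and Greenberg–Vatsal Prop. 3.7; not restated.
-- TODO(general form): Cor. 18 for the full `Λ = ℤ_p[Δ]⟦Γ⟧` (all branches `ω^i`), and the good
-- ordinary clause without an irreducibility hypothesis.

References: [Wuthrich2014] Thm. 1 (p. 381), p. 382, Cor. 7 (p. 386), §3 (p. 390), §3.2 (p. 394),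
Lemma 17 (p. 397), Cor. 18 (p. 398); [MazurTateTeitelbaum1986] §I.10, §I.12–I.14;
[GreenbergVatsal2000] Prop. 3.7; [Stevens1989] Thm. 4.6.
-/

noncomputable section

open scoped Classical MatrixGroups ModularForm

open CongruenceSubgroup WeierstrassCurve Literature.NumberTheory.EllipticCurves
  Literature.NumberTheory.EllipticCurves.ModularForms

namespace Literature.NumberTheory.EllipticCurves.Wuthrich2014

/-- **Wuthrich 2014, Cor. 18 (multiplicative clause): `L_p(E) ∈ Λ` at an odd multiplicative prime,
for EVERY `E/ℚ`.** As published (Doc. Math. 19 (2014), §6 p. 398): "Corollary 18. The analytic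
`p`-adic `L`-function `L_p(E)` belongs to `Λ` for all elliptic curves `E/ℚ` with semi-stable ordinary
reduction at `p > 2`." — `L_p(E)` the analytic `p`-adic `L`-function normalised by the Néron period
(§3.2 p. 394: "with the "good choice" of the Néron differential `ω = ω_{E_•}` … `Col(loc(z)) =
L_p(E_•) ∈ Λ`"; §1 Thm. 1 / Cor. 7: `p`-integrality of the modular symbols `[r]^±_{E_•}` at odd
semi-stable `p`). Transcription (module docstring): for a globally minimal `W`, a prime `p ≠ 2` of
MULTIPLICATIVE reduction, `f` the newform of `E` and `ϖ · Ω_E = Ω⁺_f`: THE `Ω⁺_f`-normalised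
Mazur–Tate–Teitelbaum function `L` (`IsMultPAdicLFunctionOf f p (-1) L` at a non-split prime,
`IsSplitMultPAdicLFunctionOf f p L` at a split prime) satisfies `ϖ · L = ι G` for some
`G ∈ Λ = ℤ_p⟦T⟧`. No image, semistability-away-from-`p` or (ram) hypothesis. Nothing asserted
(named fact).
-- TODO(general form): all branches of `Λ = ℤ_p[Δ]⟦Γ⟧`; the good ordinary clause (tree:
-- `padicLFunction_mem_iwasawaAlgebra`, with `E[p]` irreducible).
[cite: Wuthrich2014, Cor. 18 (p. 398) with §3.2 (p. 394), Thm. 1 (p. 381) and Cor. 7 (p. 386)]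
[cite: MazurTateTeitelbaum1986, §I.10 and §I.12–I.14] -/
def corollary18_padicLFunction_mem_iwasawaAlgebra_multiplicative : Prop :=
  ∀ (W : WeierstrassCurve ℚ) [W.IsElliptic] [W.IsGloballyMinimal] (p : ℕ) [Fact p.Prime]
    {N : ℕ} [NeZero N] {f : CuspForm (Gamma0 N) 2},
    p ≠ 2 → W.HasMultiplicativeReductionAtPrime p → IsNewformOf W f →
    ∀ (ϖ : ℚ), (ϖ : ℝ) * W.realPeriodRat = plusPeriod f →
      (¬ W.HasSplitMultiplicativeReductionAtPrime p →
        ∀ L : PowerSeries ℚ_[p], IsMultPAdicLFunctionOf f p (-1) L →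
          ∃ G : IwasawaAlgebra p, iwasawaToPowerSeries p G = PowerSeries.C ((ϖ : ℚ) : ℚ_[p]) * L) ∧
      (W.HasSplitMultiplicativeReductionAtPrime p →
        ∀ L : PowerSeries ℚ_[p], IsSplitMultPAdicLFunctionOf f p L →
          ∃ G : IwasawaAlgebra p, iwasawaToPowerSeries p G = PowerSeries.C ((ϖ : ℚ) : ℚ_[p]) * L)

end Literature.NumberTheory.EllipticCurves.Wuthrich2014

end
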